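import Mathlib
import Summits.ValiantsHypothesis.ValiantsHypothesis.Theses.ValuativeGCT
import Summits.ValiantsHypothesis.ValiantsHypothesis.Theorems.CutBites.Negative.NoCutInOddDegree
import Literature.NumberTheory.DiophantineGeometry.DetStabilizerKronecker
import Literature.NumberTheory.DiophantineGeometry.SchurWeylPlethysmRenameProofs

/-!
# `ValuativeGCT.ValuativeFlip` (stmt-ValiantsHypothesis-12624), line skew-restriction-rank —
# Stub 1 `stub_stabInv_le_explicit`: abstract `Stab_End(det_m)`-invariants are explicit invariants

The EASY HALF OF FROBENIUS in the route's conventions.  A function on `End(ℂ^{m×m})` (variables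
`X (j, i)`, row slot `j : MatIdx m`, matrix position `i : MatIdx m = Fin m ×ₗ Fin m`) that is invariant under
the row action `φ_M : X (j, i) ↦ ∑_l M l i • X (j, l)` for EVERY `M` in the `End`-stabiliser of `det_m`
(`linSubst M det_m = det_m`, column convention `linSubst M (X i) = ∑_l M l i • X l`) is in particular
invariant under the row-wise unimodular sandwiches `X_j ↦ P X_j Q` (`det P = det Q = 1`) and under the
row-wise transpose `X_j ↦ X_jᵀ`, because each of these substitutions IS `φ_M` for an admissible `M`:

* the sandwich matrix `M l i = P i₁ l₁ * Q l₂ i₂` is the `toLex`-reindexing of `Pᵀ ⊗ₖ Q`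
  (`sandwichMatrix_eq_reindex_kronecker`), so the tree's `linSubst_kronecker_detPoly`
  (`(a ⊗ₖ b) · det = det a · det b · det`), transported along `detFormLex = rename toLex detPoly` by the
  tree's `rename_linSubst`, gives `linSubst M det_m = det Pᵀ · det Q · det_m = det_m`
  (`linSubst_sandwichMatrix_detFormLex`); and `φ_M` is literally the displayed sandwich substitution;
* the swap matrix `M l i = [l = swap i]` fixes `det_m` (`det Xᵀ = det X`, the tree's
  `CutBites.Negative.linSubst_swapMatrix_detFormLex`), and `φ_M` equals the displayed transpose
  substitution (`rowAct_swapMatrix_eq`, one `Finset.sum_ite_eq`).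

Then `iInf_le` twice.  The statement is the skeleton's stub with the named arguments `(R := ℂ)`,
`(M := …)` replaced by type ascriptions (no `:=` inside the signature, so that the stub registry does not
truncate it); the elaborated statement is syntactically identical.  [Frobenius 1897; BLMW 2011 §5.2; folklore]
-/

namespace Summit.ValiantsHypothesis.ValiantsHypothesis.Theorems.ValuativeFlip

open Literature.NumberTheory.DiophantineGeometry Literature.Computability.AlgebraicComplexity
open Summit.ValiantsHypothesis.ValiantsHypothesis.Theorems.CutBites.Negative
  (sum_swapMatrix_smul linSubst_swapMatrix_detFormLex)
open MvPolynomial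
open scoped BigOperators Matrix Kronecker

-- `Summit.ValiantsHypothesis.ValiantsHypothesis.…` is the tree's mandated single-conjunct layout (Sub = Summit).
set_option linter.dupNamespace false

noncomputable section

/-! ### The unimodular sandwich `X ↦ P X Q` in the `linSubst` convention -/

/-- The matrix of the sandwich `X ↦ P X Q` in the `linSubst` convention `X_i ↦ ∑_l M l i • X_l`,
`M l i = P i₁ l₁ * Q l₂ i₂`, is the `toLex`-reindexing of the Kronecker product `Pᵀ ⊗ₖ Q`
(definitionally). [folklore] -/
theorem sandwichMatrix_eq_reindex_kronecker {m : ℕ} (P Q : Matrix (Fin m) (Fin m) ℂ) :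
    (Matrix.of fun l i : MatIdx m => P (ofLex i).1 (ofLex l).1 * Q (ofLex l).2 (ofLex i).2)
      = Matrix.reindex (toLex : Fin m × Fin m ≃ MatIdx m) toLex (Pᵀ ⊗ₖ Q) :=
  Matrix.ext fun _ _ => rfl

/-- **Unimodular sandwiches stabilise `det_m`**: `det (P X Q) = det X` for `det P = det Q = 1`, i.e. the
sandwich matrix lies in the crux's `End`-stabiliser of `det_m` — the tree's `linSubst_kronecker_detPoly`
for `Pᵀ ⊗ₖ Q`, transported along `detFormLex = rename toLex detPoly` (`rename_linSubst`).
[BLMW 2011 §5.2; folklore] -/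
theorem linSubst_sandwichMatrix_detFormLex {m : ℕ} (P Q : Matrix (Fin m) (Fin m) ℂ) (hP : P.det = 1)
    (hQ : Q.det = 1) :
    linSubst (MatIdx m) ℂ (Matrix.of fun l i : MatIdx m =>
        P (ofLex i).1 (ofLex l).1 * Q (ofLex l).2 (ofLex i).2) (detFormLex ℂ m) = detFormLex ℂ m := by
  rw [sandwichMatrix_eq_reindex_kronecker, detFormLex, ← rename_linSubst, linSubst_kronecker_detPoly,
    Matrix.det_transpose, hP, hQ, mul_one, one_smul]

/-! ### The transpose `X ↦ Xᵀ` in the `linSubst` convention -/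

/-- The crux's row action `X (j, i) ↦ ∑_l M l i • X (j, l)` of the swap matrix `M l i = [l = swap i]` is
the row-wise transpose `X (j, i) ↦ X (j, swap i)` (as substitution functions). [folklore] -/
theorem rowAct_swapMatrix_eq (m : ℕ) :
    (fun p : MatIdx m × MatIdx m => ∑ l : MatIdx m,
        (Matrix.of fun l i : MatIdx m => if l = toLex ((ofLex i).2, (ofLex i).1) then (1 : ℂ) else 0) l p.2 •
          (MvPolynomial.X (p.1, l) : MvPolynomial (MatIdx m × MatIdx m) ℂ))
      = fun p : MatIdx m × MatIdx m =>
          (MvPolynomial.X (p.1, toLex ((ofLex p.2).2, (ofLex p.2).1)) : MvPolynomial (MatIdx m × MatIdx m) ℂ) :=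
  funext fun p => sum_swapMatrix_smul (fun l => (X (p.1, l) : MvPolynomial (MatIdx m × MatIdx m) ℂ)) p.2

/-! ### Stub 1 -/

/-- **Stub 1 — the easy half of Frobenius in the route's conventions: abstract `Stab_End(det_m)`-invariants
are explicit invariants.**  A function on `End(ℂ^{m×m})` (variables `X (j, i)`, row slot `j`, matrix
position `i = toLex (c, d)`) that is invariant under `A ↦ A·M` for EVERY `M` with `linSubst M det_m = det_m`
(the crux's third factor, verbatim) is in particular invariant under the row-wise unimodular sandwiches
`X_j ↦ P X_j Q` (`det P = det Q = 1`) and under the row-wise transpose `X_j ↦ X_jᵀ`: each of these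
substitutions IS `φ_M` for an admissible `M` — the sandwich matrix `M l i = P i₁ l₁ * Q l₂ i₂`, the
`toLex`-reindexing of `Pᵀ ⊗ₖ Q` (`linSubst_sandwichMatrix_detFormLex`: `det (P X Q) = det X`), and the swap
matrix `M l i = [l = swap i]` (`linSubst_swapMatrix_detFormLex`: `det Xᵀ = det X`; `rowAct_swapMatrix_eq`
identifies `φ_M` with the displayed substitution) — and then `iInf_le`.
[Frobenius 1897; BLMW 2011 §5.2; folklore] -/
theorem stub_stabInv_le_explicit (m : ℕ) :
    (⨅ (M : Matrix (MatIdx m) (MatIdx m) ℂ)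
        (_ : linSubst (MatIdx m) ℂ M (detFormLex ℂ m) = detFormLex ℂ m),
        LinearMap.ker ((MvPolynomial.aeval fun p : MatIdx m × MatIdx m =>
            ∑ l : MatIdx m, M l p.2 •
              (MvPolynomial.X (p.1, l) : MvPolynomial (MatIdx m × MatIdx m) ℂ)).toLinearMap -
          (LinearMap.id : MvPolynomial (MatIdx m × MatIdx m) ℂ →ₗ[ℂ] MvPolynomial (MatIdx m × MatIdx m) ℂ)))
      ≤ (⨅ (P : Matrix (Fin m) (Fin m) ℂ) (Q : Matrix (Fin m) (Fin m) ℂ) (_ : P.det = 1)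
            (_ : Q.det = 1),
          LinearMap.ker ((MvPolynomial.aeval fun p : MatIdx m × MatIdx m =>
              ∑ l : MatIdx m, (P (ofLex p.2).1 (ofLex l).1 * Q (ofLex l).2 (ofLex p.2).2) •
                (MvPolynomial.X (p.1, l) : MvPolynomial (MatIdx m × MatIdx m) ℂ)).toLinearMap -
            (LinearMap.id : MvPolynomial (MatIdx m × MatIdx m) ℂ →ₗ[ℂ] MvPolynomial (MatIdx m × MatIdx m) ℂ))) ⊓
        LinearMap.ker ((MvPolynomial.aeval fun p : MatIdx m × MatIdx m =>
            (MvPolynomial.X (p.1, toLex ((ofLex p.2).2, (ofLex p.2).1)) :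
              MvPolynomial (MatIdx m × MatIdx m) ℂ)).toLinearMap -
          (LinearMap.id : MvPolynomial (MatIdx m × MatIdx m) ℂ →ₗ[ℂ] MvPolynomial (MatIdx m × MatIdx m) ℂ)) := by
  refine le_inf ?_ ?_
  · refine le_iInf fun P => le_iInf fun Q => le_iInf fun hP => le_iInf fun hQ => ?_
    exact iInf₂_le_of_le
      (Matrix.of fun l i : MatIdx m => P (ofLex i).1 (ofLex l).1 * Q (ofLex l).2 (ofLex i).2)
      (linSubst_sandwichMatrix_detFormLex P Q hP hQ) le_rfl
  · refine iInf₂_le_of_le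
      (Matrix.of fun l i : MatIdx m => if l = toLex ((ofLex i).2, (ofLex i).1) then (1 : ℂ) else 0)
      (linSubst_swapMatrix_detFormLex m) ?_
    rw [rowAct_swapMatrix_eq m]

end

end Summit.ValiantsHypothesis.ValiantsHypothesis.Theorems.ValuativeFlip
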